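/-
Copyright: the b2b-balaban T⁴-continuum CRUX team, row NE7b leaf lineage `t4-ne7b-formalise-leaf-02` (gen 135). Project licence.
-/
import Summits.QuantumFields.BalabanUV.T4Continuum.Spine.NE7b.AdmissibleFloorSqLetter
import Summits.QuantumFields.BalabanUV.T4Continuum.Spine.NE7b.SineTentSqLetter
import Summits.QuantumFields.BalabanUV.T4Continuum.Spine.NE7b.CurlTermsLinear
import Summits.QuantumFields.BalabanUV.T4Continuum.Spine.NE7b.PlaquetteTermDisplacement
import Summits.QuantumFields.BalabanUV.T4Continuum.Spine.NE7b.AveragedCurlFormSplit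
import Summits.QuantumFields.BalabanUV.T4Continuum.Spine.NE7b.AverageTermsPrinted
import Summits.QuantumFields.BalabanUV.T4Continuum.Spine.NE7b.AverageTermsLinear

/-!
# THE FULL-FORM (h2) FLOOR AT k = 1 BY THE SUMMED-SQUARE ROUTE — NO MULTIPLICITY LETTER: `…FullFormSineFloor` ∕ `…FullFormSineFloorPrinted` with the IMS error
# of `…AdmissibleFloorSqLetter` (`ε = ℓ²Λ²ab` per family) fed by `…SineTentSqLetter` (`Λ₁ = π∕2L` for the plaquettes, `Λ₂ = (d+1)(n−1)·π∕2L` for the averages):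
# `((c_loc − (1+t⁻¹)·((π∕2L)²·4·2(d−1) + (|ω|n)²·((d+1)(n−1)π∕2L)²·n^{d+1}·n))∕(1+t))·Σ_c‖B c‖² ≤ Σ_P X_P(B)² + [n^{d−2}·]Σ_{(y,κ)}‖(Q₀(V₀)B)(n·y,κ)‖²` on `good`
# — by value (d = 4): `ε_curl·L² = 6π² ≈ 59.2` (was `96π² ≈ 947`), `ε_avg·L² = 25π²∕16 ≈ 15.4` at `ω = n^{−5}`, n = 2 (was `825π² ≈ 8 142`)
# (row NE7b, node U5c; residual (R2′) family (2), letter (ℓ1); capstone junctions — the refuter's located item Q-v128-1, PRICING-NE7b v128 F762)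

Cell `pub-balaban`, sub-cell `t4`, spine estimate NE7b (`T4WeightBudget.RelWeightBound`; the cell's OWN estimate — NOT PRINTED in [Bałaban 1983–89],
NOT PROVED).  Crux-route work under `Spine/NE7b/`; NOTHING of Bałaban's estimates is asserted; no `def`; zero `sorry`; no `T4Continuum/Support` leaf
(FREEZE (0)).  Imports BY NAME: this lineage's `…AdmissibleFloorSqLetter` (AFSQ: `ims_floor_of_linear_terms_two_sq`), `…SineTentSqLetter` (STSQ:
`sum_sq_prod_sin_tent_sub_le_of_unit` ∕ `_of_disp`), `…CurlTermsLinear` (CTL), `…PlaquetteTermDisplacement` (PTD), `…AveragedCurlFormSplit` (ACFS),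
`…TorusPlaquetteIncidence` (TPI), `…AverageTermsLinear` (ATL), `…TorusAverageIncidence` (TAI), `…AverageTermsPrinted` (ATP) and STQ `sum_sq_prod_sin_tent_eq_one`.

WHY.  `…FullFormSineFloor.ims_floor_full_form` (FFSF) and `…FullFormSineFloorPrinted` (FFSP) discharge every bookkeeping letter of the (h2) slot's full-form
floor at `k = 1` through AFS2's `(hlip, hμ)` route, whose error `ε = μℓ²λ²ab` carries the multiplicity `μ` (`2^d` for plaquettes, `(n^{d+1}+1)·2^d` for the average
terms).  The refuter's desk located (Q-v128-1) that the summed-square route removes `μ` at no cost for product partitions; AFSQ + STSQ type it.  THIS FILE is the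
pair of capstones on that route — the SAME displayed inputs as FFSF ∕ FFSP §2 (`good`, `hloc`, the curl transports `w`, the background `V₀`, the weight `ω`), a
smaller displayed constant.  FFSF ∕ FFSP stay the statements of record on the `(hlip, hμ)` route; nothing is superseded in the tree.

WHAT IS PROVED ([folklore]):
* §1 **`ims_floor_of_sine_tent_partition_two_unit_disp_sq`** — `…SineTentFloorTwoFamilies.ims_floor_of_sine_tent_partition_two_unit_disp`'s twin on the sq route:
  family 1 in the plaquette shape (`Λ₁ = π∕2L`), family 2 with `ℓ¹`-witnesses of length `≤ D₂` (`Λ₂ = D₂π∕2L`) ⊢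
  `((c_loc − (1+t⁻¹)·(ℓ₁²(π∕2L)²a₁b₁ + ℓ₂²(D₂π∕2L)²a₂b₂))∕(1+t))·Σ_c‖x c‖² ≤ F x`.
* §2 **`ims_floor_full_form_sq`** — FFSF `ims_floor_full_form`'s twin: curl (`ℓ₁ = 1, a₁ = 4, b₁ = 2(d−1)`) + average (`ℓ₂ = |ω|n, a₂ = n^{d+1}, b₂ = n,
  D₂ = (d+1)(n−1)`) families, parameters `(ω, w′, Y)`.
* §3 **`ims_floor_full_form_printed_weighted_sq`** — FFSP §2's twin: the average family = print's `n^{d−2}·Σ_{(y,κ)}‖(Q₀(V₀)(lift B))(n·y,κ)‖²` ([B7] (125) via ATP),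
  `ω = √(n^{d−2})·n^{−(d+1)}`.
By value (d = 4, t = 1, c_loc = 1; displayed constants): `ε_curl·L² = (π²∕4)·24 = 6π² ≈ 59.2`; `ε_avg·L²` (n = 2) `= n^{−2d}·(5π∕2)²·n⁶ = 25π²∕16 ≈ 15.4` at
`ω = n^{−5}`, `25π²∕4 ≈ 61.7` with the prefactor inside (§3); floor informative iff `L² > 2(ε_curl + ε_avg)L²`: `L ≥ 13` ∕ `L ≥ 16` (was `135` ∕ `259` on the `(hlip, hμ)` route).

NOT HERE (honest): the local floor `c_loc` (Lemma 5.5 — the per-cube gauge letters, currency Q-leaf05-g157-1), `good`, the curl transports `w`, the (A3) decision `Q₀` vs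
`L(Q(V₀)·)`; anything of Bałaban's estimates.  BY-NAME EFFECT ON THE WALL: NONE.  NE7b NOT PRINTED ∕ NOT PROVED; spine PROVED 0∕9; rung (B)+1 on ONE finite T⁴ —
NOT infinite volume, NOT the mass gap, NOT Clay.
HONEST DEPENDENCY: continuum YM on T⁴ ⇐ BetaPertH ∧ nine spine estimates (0/9 proved); BetaPertH ⇐ (D1) ∧ (D4) ∧ CAP+tail; G-an2-4 gates asym, D1 and NE2/3/4.
-/

set_option autoImplicit false

noncomputable section

open Finset
open Literature.MathematicalPhysics.QuantumFieldTheory.Balaban1983to89.B14.TentUnityTorus (tentZ)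
open Literature.MathematicalPhysics.QuantumFieldTheory.Balaban1983to89.B7Prop1Explicit (Site seg hol treeWord boxVec U1 hol_mem)
open Literature.MathematicalPhysics.QuantumFieldTheory.Balaban1983to89.B7Eq78Linearization (conjR conjR_add conjR_smul_real)
open Literature.MathematicalPhysics.QuantumFieldTheory.Balaban1983to89.B7Prop3GeneralLinear (Q0cov)
open Literature.MathematicalPhysics.QuantumFieldTheory.Balaban1983to89.T4TermwiseTorus (tcls)
open Summit.QuantumFields.BalabanUV.T4Continuum.NE7b.AdmissibleFloorSqLetter (ims_floor_of_linear_terms_two_sq)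
open Summit.QuantumFields.BalabanUV.T4Continuum.NE7b.SineTentQuadraticPartition (sum_sq_prod_sin_tent_eq_one)
open Summit.QuantumFields.BalabanUV.T4Continuum.NE7b.SineTentSqLetter (sum_sq_prod_sin_tent_sub_le_of_disp sum_sq_prod_sin_tent_sub_le_of_unit)
open Summit.QuantumFields.BalabanUV.T4Continuum.NE7b.CurlTermsLinear (norm_curlMap_le sum_sq_norm_curlMaps_eq)
open Summit.QuantumFields.BalabanUV.T4Continuum.NE7b.PlaquetteTermDisplacement (exists_unit_plaquetteBonds)
open Summit.QuantumFields.BalabanUV.T4Continuum.NE7b.AveragedCurlFormSplit (card_image_four_le)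
open Summit.QuantumFields.BalabanUV.T4Continuum.NE7b.TorusPlaquetteIncidence (card_plaquettes_through_bond_le)
open Summit.QuantumFields.BalabanUV.T4Continuum.NE7b.AverageTermsLinear (norm_avgMap_le sum_sq_norm_avgMaps_eq)
open Summit.QuantumFields.BalabanUV.T4Continuum.NE7b.TorusAverageIncidence (card_image_avgBonds_le card_terms_through_bond_le
  exists_displacement_avgBonds)
open Summit.QuantumFields.BalabanUV.T4Continuum.NE7b.AverageTermsPrinted (Q0cov_eq_weighted_sum tcls_qb_add_boxVec_add)

namespace Summit.QuantumFields.BalabanUV.T4Continuum.NE7b.FullFormSineFloorSq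

/-! ## §1 Two families on the torus with the sine-tent partition, summed-square route -/

section TwoFamilies

variable {A : Type*} [Fintype A] [DecidableEq A]
variable {J₁ J₂ C : Type*} [Fintype J₁] [Fintype J₂] [Fintype C]
variable {W V₁ V₂ : Type*} [NormedAddCommGroup W] [NormedSpace ℝ W]
  [NormedAddCommGroup V₁] [NormedSpace ℝ V₁] [NormedAddCommGroup V₂] [NormedSpace ℝ V₂]

/-- **THE TWO-FAMILY (h2) FLOOR WITH THE SINE-TENT PARTITION, SUMMED-SQUARE ROUTE** — AFSQ `ims_floor_of_linear_terms_two_sq` with `hpart` exact (STQ) and the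
`hsq_i` letters from STSQ: family 1 in the plaquette shape (`Λ₁ = π∕(2L)`), family 2 with displacement witnesses (`Λ₂ = D₂·π∕(2L)`) ⊢
`((c_loc − (1+t⁻¹)·(ℓ₁²·(π∕(2L))²·a₁b₁ + ℓ₂²·(D₂π∕(2L))²·a₂b₂))∕(1+t))·Σ_c‖x c‖² ≤ F x` — no `μ`. [folklore] -/
theorem ims_floor_of_sine_tent_partition_two_unit_disp_sq [DecidableEq C] (L M N : ℕ) [NeZero M] [NeZero N] (hL : 0 < L) (hM : 2 ≤ M)
    (hN : N = M * L) (c₀ : ℕ)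
    (inc₁ : J₁ → Finset C) (R₁ : J₁ → C → W →ₗ[ℝ] V₁) {ℓ₁ : ℝ} (hR₁ : ∀ j c v, ‖R₁ j c v‖ ≤ ℓ₁ * ‖v‖)
    (inc₂ : J₂ → Finset C) (R₂ : J₂ → C → W →ₗ[ℝ] V₂) {ℓ₂ : ℝ} (hR₂ : ∀ j c v, ‖R₂ j c v‖ ≤ ℓ₂ * ‖v‖)
    (pt : C → A → ZMod N) (ref₁ : J₁ → C) (ref₂ : J₂ → C)
    (hunit₁ : ∀ j, ∀ b ∈ inc₁ j, pt b = pt (ref₁ j) ∨ ∃ ν, pt b = Function.update (pt (ref₁ j)) ν (pt (ref₁ j) ν + 1))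
    (D₂ : ℕ)
    (hdisp₂ : ∀ j, ∀ b ∈ inc₂ j, ∃ wp wm : A → ℕ,
      pt b = pt (ref₂ j) + (fun ν => ((wp ν : ℕ) : ZMod N)) - (fun ν => ((wm ν : ℕ) : ZMod N)) ∧ ∑ ν, wp ν + ∑ ν, wm ν ≤ D₂)
    {a₁ b₁ a₂ b₂ : ℕ} (ha₁ : ∀ j, (inc₁ j).card ≤ a₁) (hb₁ : ∀ c, (Finset.univ.filter fun j => c ∈ inc₁ j).card ≤ b₁)
    (ha₂ : ∀ j, (inc₂ j).card ≤ a₂) (hb₂ : ∀ c, (Finset.univ.filter fun j => c ∈ inc₂ j).card ≤ b₂)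
    (good : (C → W) → Prop) {cloc : ℝ}
    (hloc : ∀ (S : A → ZMod M) (x : C → W), good x →
      cloc * ∑ c, ‖(∏ ν, Real.sin (Real.pi / 2 * tentZ (L : ℝ) (pt c ν - (((S ν).val * L + c₀ : ℕ) : ZMod N)))) • x c‖ ^ 2
        ≤ ∑ j, ‖∑ c ∈ inc₁ j, R₁ j c ((∏ ν, Real.sin (Real.pi / 2 * tentZ (L : ℝ) (pt c ν - (((S ν).val * L + c₀ : ℕ) : ZMod N)))) • x c)‖ ^ 2
          + ∑ j, ‖∑ c ∈ inc₂ j, R₂ j c ((∏ ν, Real.sin (Real.pi / 2 * tentZ (L : ℝ) (pt c ν - (((S ν).val * L + c₀ : ℕ) : ZMod N)))) • x c)‖ ^ 2)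
    (F : (C → W) → ℝ)
    (hF : ∀ x, good x → ∑ j, ‖∑ c ∈ inc₁ j, R₁ j c (x c)‖ ^ 2 + ∑ j, ‖∑ c ∈ inc₂ j, R₂ j c (x c)‖ ^ 2 ≤ F x)
    {t : ℝ} (ht : 0 < t) (x : C → W) (hx : good x) :
    (cloc - (1 + t⁻¹) * (ℓ₁ ^ 2 * (Real.pi / (2 * L)) ^ 2 * a₁ * b₁ + ℓ₂ ^ 2 * (D₂ * (Real.pi / (2 * L))) ^ 2 * a₂ * b₂)) / (1 + t)
      * ∑ c, ‖x c‖ ^ 2 ≤ F x :=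
  ims_floor_of_linear_terms_two_sq (ι := A → ZMod M) inc₁ R₁ hR₁ inc₂ R₂ hR₂
    (fun (S : A → ZMod M) (c : C) => ∏ ν, Real.sin (Real.pi / 2 * tentZ (L : ℝ) (pt c ν - (((S ν).val * L + c₀ : ℕ) : ZMod N))))
    (fun c => sum_sq_prod_sin_tent_eq_one L M N hL hM hN c₀ (pt c)) ref₁ ref₂
    (Λ₁ := Real.pi / (2 * L)) (Λ₂ := D₂ * (Real.pi / (2 * L)))
    (sum_sq_prod_sin_tent_sub_le_of_unit L M N hL hM hN c₀ pt inc₁ ref₁ hunit₁)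
    (sum_sq_prod_sin_tent_sub_le_of_disp L M N hL hM hN c₀ pt inc₂ ref₂ D₂ hdisp₂)
    ha₁ hb₁ ha₂ hb₂ good hloc F hF ht x hx

end TwoFamilies

/-! ## §2 The full form, parameters `(ω, w′, Y)` — `…FullFormSineFloor.ims_floor_full_form`'s twin -/

variable {d : ℕ}
variable {𝔸 : Type*} [NormedRing 𝔸] [NormedAlgebra ℂ 𝔸] [NormOneClass 𝔸] [CompleteSpace 𝔸]

omit [CompleteSpace 𝔸] in
/-- **THE FULL-FORM (h2) FLOOR AT k = 1, SUMMED-SQUARE ROUTE** (FFSF `ims_floor_full_form` with `ε_curl = (π∕2L)²·4·2(d−1)`, `ε_avg = (|ω|n)²·((d+1)(n−1)π∕2L)²·n^{d+1}·n`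
— no `2^d`, no `(n^{d+1}+1)·2^d`).  Displayed: `c_loc` on `good`. [folklore] -/
theorem ims_floor_full_form_sq (n M L Mp : ℕ) [NeZero n] [NeZero M] [NeZero (n * M)] [Fact (1 < n * M)] [NeZero Mp]
    (hL : 0 < L) (hMp : 2 ≤ Mp) (hN : n * M = Mp * L) (c₀ : ℕ)
    (ι : (Fin d → ZMod (n * M)) × {a : Fin d × Fin d // a.1 < a.2} → Fin 4 → (Fin d → ZMod (n * M)) × Fin d)
    (hι : ∀ x a, ι (x, a) = ![(x, a.1.1), (x + Pi.single a.1.1 1, a.1.2), (x + Pi.single a.1.2 1, a.1.1), (x, a.1.2)])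
    (w : (Fin d → ZMod (n * M)) × {a : Fin d × Fin d // a.1 < a.2} → Fin 3 → 𝔸ˣ) (hw : ∀ P i, w P i ∈ U1 𝔸)
    (R : (Fin d → ZMod (n * M)) × {a : Fin d × Fin d // a.1 < a.2} → (Fin d → ZMod (n * M)) × Fin d → 𝔸 →ₗ[ℝ] 𝔸)
    (hR : ∀ P c, R P c =
        if c = ι P 0 then LinearMap.id
        else if c = ι P 1 then LinearMap.mk ⟨conjR (w P 0), conjR_add (w P 0)⟩ (conjR_smul_real (w P 0))
        else if c = ι P 2 then -LinearMap.mk ⟨conjR (w P 1), conjR_add (w P 1)⟩ (conjR_smul_real (w P 1))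
        else if c = ι P 3 then -LinearMap.mk ⟨conjR (w P 2), conjR_add (w P 2)⟩ (conjR_smul_real (w P 2))
        else 0)
    (X : (Fin d → ZMod (n * M)) × {a : Fin d × Fin d // a.1 < a.2} → ((Fin d → ZMod (n * M)) → Fin d → 𝔸) → ℝ)
    (hX : ∀ (y : Fin d → ZMod (n * M)) (a : {a : Fin d × Fin d // a.1 < a.2}) (B : (Fin d → ZMod (n * M)) → Fin d → 𝔸), X (y, a) B =
      ‖B y a.1.1 + conjR (w (y, a) 0) (B (y + Pi.single a.1.1 1) a.1.2) - conjR (w (y, a) 1) (B (y + Pi.single a.1.2 1) a.1.1)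
        - conjR (w (y, a) 2) (B y a.1.2)‖)
    (ιA : (Fin d → ZMod M) × Fin d → (Fin d → Fin n) × Fin n → (Fin d → ZMod (n * M)) × Fin d)
    (hιA : ∀ y κ r t, ιA (y, κ) (r, t) =
      ((fun i => (((y i).val * n + (r i : ℕ) : ℕ) : ZMod (n * M))) + Pi.single κ ((t : ℕ) : ZMod (n * M)), κ))
    (ω : ℝ) (w' : (Fin d → ZMod M) × Fin d → (Fin d → Fin n) × Fin n → 𝔸ˣ) (hw' : ∀ j rt, w' j rt ∈ U1 𝔸)
    (R' : (Fin d → ZMod M) × Fin d → (Fin d → ZMod (n * M)) × Fin d → 𝔸 →ₗ[ℝ] 𝔸)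
    (hR' : ∀ j c, R' j c = ω • ∑ rt ∈ Finset.univ.filter (fun rt => ιA j rt = c),
        LinearMap.mk ⟨conjR (w' j rt), conjR_add (w' j rt)⟩ (conjR_smul_real (w' j rt)))
    (Y : (Fin d → ZMod M) × Fin d → ((Fin d → ZMod (n * M)) → Fin d → 𝔸) → ℝ)
    (hY : ∀ j B, Y j B = ‖ω • ∑ rt, conjR (w' j rt) (B (ιA j rt).1 (ιA j rt).2)‖)
    (good : ((Fin d → ZMod (n * M)) × Fin d → 𝔸) → Prop) {cloc : ℝ}
    (hloc : ∀ (S : Fin d → ZMod Mp) (x : (Fin d → ZMod (n * M)) × Fin d → 𝔸), good x →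
      cloc * ∑ c, ‖(∏ ν, Real.sin (Real.pi / 2 * tentZ (L : ℝ) (c.1 ν - (((S ν).val * L + c₀ : ℕ) : ZMod (n * M))))) • x c‖ ^ 2
        ≤ ∑ P, ‖∑ c ∈ Finset.univ.image (ι P),
              R P c ((∏ ν, Real.sin (Real.pi / 2 * tentZ (L : ℝ) (c.1 ν - (((S ν).val * L + c₀ : ℕ) : ZMod (n * M))))) • x c)‖ ^ 2
          + ∑ j, ‖∑ c ∈ Finset.univ.image (ιA j),
              R' j c ((∏ ν, Real.sin (Real.pi / 2 * tentZ (L : ℝ) (c.1 ν - (((S ν).val * L + c₀ : ℕ) : ZMod (n * M))))) • x c)‖ ^ 2)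
    {t : ℝ} (ht : 0 < t) (x : (Fin d → ZMod (n * M)) × Fin d → 𝔸) (hx : good x) :
    (cloc - (1 + t⁻¹) * ((1 : ℝ) ^ 2 * (Real.pi / (2 * L)) ^ 2 * (4 : ℕ) * (2 * (d - 1) : ℕ)
        + (|ω| * n) ^ 2 * (((d + 1) * (n - 1) : ℕ) * (Real.pi / (2 * L))) ^ 2 * (n ^ (d + 1) : ℕ) * (n : ℕ))) / (1 + t)
        * ∑ c, ‖x c‖ ^ 2
      ≤ ∑ P, X P (fun y μ => x (y, μ)) ^ 2 + ∑ j, Y j (fun y μ => x (y, μ)) ^ 2 := by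
  classical
  have hF : ∀ z : (Fin d → ZMod (n * M)) × Fin d → 𝔸, good z →
      ∑ P, ‖∑ c ∈ Finset.univ.image (ι P), R P c (z c)‖ ^ 2 + ∑ j, ‖∑ c ∈ Finset.univ.image (ιA j), R' j c (z c)‖ ^ 2
        ≤ ∑ P, X P (fun y μ => z (y, μ)) ^ 2 + ∑ j, Y j (fun y μ => z (y, μ)) ^ 2 :=
    fun z _ => le_of_eq (by
      rw [sum_sq_norm_curlMaps_eq ι hι w R hR X hX (fun y μ => z (y, μ)),
        sum_sq_norm_avgMaps_eq n ιA ω w' R' hR' Y hY (fun y μ => z (y, μ))])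
  exact ims_floor_of_sine_tent_partition_two_unit_disp_sq (A := Fin d) L Mp (n * M) hL hMp hN c₀
    (fun P => Finset.univ.image (ι P)) R (ℓ₁ := 1) (fun P c v => norm_curlMap_le ι w hw R hR P c v)
    (fun j => Finset.univ.image (ιA j)) R' (ℓ₂ := |ω| * n) (fun j c v => norm_avgMap_le n (NeZero.pos n) ιA hιA ω w' hw' R' hR' j c v)
    Prod.fst (fun P => ι P 0) (fun j => ιA j 0) (exists_unit_plaquetteBonds ι hι)
    ((d + 1) * (n - 1)) (exists_displacement_avgBonds n ιA hιA)
    (a₁ := 4) (b₁ := 2 * (d - 1)) (a₂ := n ^ (d + 1)) (b₂ := n)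
    (fun P => card_image_four_le (ι P)) (fun c => card_plaquettes_through_bond_le ι hι c)
    (fun j => card_image_avgBonds_le n ιA j) (fun c => card_terms_through_bond_le n ιA hιA (NeZero.pos n) c)
    good hloc (fun z => ∑ P, X P (fun y μ => z (y, μ)) ^ 2 + ∑ j, Y j (fun y μ => z (y, μ)) ^ 2) hF ht x hx

/-! ## §3 The printed instance with `F^{full}`'s prefactor — `…FullFormSineFloorPrinted.ims_floor_full_form_printed_weighted`'s twin -/

omit [CompleteSpace 𝔸] in
/-- **THE FULL-FORM (h2) FLOOR AT k = 1 FOR `Σ_P X_P(B)² + n^{d−2}·Σ_j ‖(Q₀(V₀)B)(n·y, κ)‖²`, SUMMED-SQUARE ROUTE** (FFSP §2 with the error letter of §2 above;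
average family = [B7] (125) via ATP, `ω := √(n^{d−2})·(n^{d+1})⁻¹`). [folklore] -/
theorem ims_floor_full_form_printed_weighted_sq (n M L Mp : ℕ) [NeZero n] [NeZero M] [NeZero (n * M)] [Fact (1 < n * M)] [NeZero Mp]
    (hL : 0 < L) (hMp : 2 ≤ Mp) (hN : n * M = Mp * L) (c₀ : ℕ)
    (ι : (Fin d → ZMod (n * M)) × {a : Fin d × Fin d // a.1 < a.2} → Fin 4 → (Fin d → ZMod (n * M)) × Fin d)
    (hι : ∀ x a, ι (x, a) = ![(x, a.1.1), (x + Pi.single a.1.1 1, a.1.2), (x + Pi.single a.1.2 1, a.1.1), (x, a.1.2)])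
    (w : (Fin d → ZMod (n * M)) × {a : Fin d × Fin d // a.1 < a.2} → Fin 3 → 𝔸ˣ) (hw : ∀ P i, w P i ∈ U1 𝔸)
    (R : (Fin d → ZMod (n * M)) × {a : Fin d × Fin d // a.1 < a.2} → (Fin d → ZMod (n * M)) × Fin d → 𝔸 →ₗ[ℝ] 𝔸)
    (hR : ∀ P c, R P c =
        if c = ι P 0 then LinearMap.id
        else if c = ι P 1 then LinearMap.mk ⟨conjR (w P 0), conjR_add (w P 0)⟩ (conjR_smul_real (w P 0))
        else if c = ι P 2 then -LinearMap.mk ⟨conjR (w P 1), conjR_add (w P 1)⟩ (conjR_smul_real (w P 1))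
        else if c = ι P 3 then -LinearMap.mk ⟨conjR (w P 2), conjR_add (w P 2)⟩ (conjR_smul_real (w P 2))
        else 0)
    (X : (Fin d → ZMod (n * M)) × {a : Fin d × Fin d // a.1 < a.2} → ((Fin d → ZMod (n * M)) → Fin d → 𝔸) → ℝ)
    (hX : ∀ (y : Fin d → ZMod (n * M)) (a : {a : Fin d × Fin d // a.1 < a.2}) (B : (Fin d → ZMod (n * M)) → Fin d → 𝔸), X (y, a) B =
      ‖B y a.1.1 + conjR (w (y, a) 0) (B (y + Pi.single a.1.1 1) a.1.2) - conjR (w (y, a) 1) (B (y + Pi.single a.1.2 1) a.1.1)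
        - conjR (w (y, a) 2) (B y a.1.2)‖)
    (qb : (Fin d → ZMod M) → Site d) (hqb : ∀ y i, qb y i = (n : ℤ) * (((y i).val : ℕ) : ℤ))
    (ιA : (Fin d → ZMod M) × Fin d → (Fin d → Fin n) × Fin n → (Fin d → ZMod (n * M)) × Fin d)
    (hιA : ∀ y κ r t, ιA (y, κ) (r, t) =
      ((fun i => (((y i).val * n + (r i : ℕ) : ℕ) : ZMod (n * M))) + Pi.single κ ((t : ℕ) : ZMod (n * M)), κ))
    (V₀ : Site d → Fin d → 𝔸ˣ) (hV : ∀ x κ, V₀ x κ ∈ U1 𝔸)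
    (R' : (Fin d → ZMod M) × Fin d → (Fin d → ZMod (n * M)) × Fin d → 𝔸 →ₗ[ℝ] 𝔸)
    (hR' : ∀ j c, R' j c = (Real.sqrt ((n : ℝ) ^ (d - 2)) * ((n : ℝ) ^ (d + 1))⁻¹) • ∑ rt ∈ Finset.univ.filter (fun rt => ιA j rt = c),
        LinearMap.mk ⟨conjR (hol V₀ (qb j.1) (treeWord (boxVec n rt.1) ++ seg j.2 ((rt.2 : ℕ) : ℤ))),
          conjR_add (hol V₀ (qb j.1) (treeWord (boxVec n rt.1) ++ seg j.2 ((rt.2 : ℕ) : ℤ)))⟩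
          (conjR_smul_real (hol V₀ (qb j.1) (treeWord (boxVec n rt.1) ++ seg j.2 ((rt.2 : ℕ) : ℤ)))))
    (good : ((Fin d → ZMod (n * M)) × Fin d → 𝔸) → Prop) {cloc : ℝ}
    (hloc : ∀ (S : Fin d → ZMod Mp) (x : (Fin d → ZMod (n * M)) × Fin d → 𝔸), good x →
      cloc * ∑ c, ‖(∏ ν, Real.sin (Real.pi / 2 * tentZ (L : ℝ) (c.1 ν - (((S ν).val * L + c₀ : ℕ) : ZMod (n * M))))) • x c‖ ^ 2
        ≤ ∑ P, ‖∑ c ∈ Finset.univ.image (ι P),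
              R P c ((∏ ν, Real.sin (Real.pi / 2 * tentZ (L : ℝ) (c.1 ν - (((S ν).val * L + c₀ : ℕ) : ZMod (n * M))))) • x c)‖ ^ 2
          + ∑ j, ‖∑ c ∈ Finset.univ.image (ιA j),
              R' j c ((∏ ν, Real.sin (Real.pi / 2 * tentZ (L : ℝ) (c.1 ν - (((S ν).val * L + c₀ : ℕ) : ZMod (n * M))))) • x c)‖ ^ 2)
    {t : ℝ} (ht : 0 < t) (x : (Fin d → ZMod (n * M)) × Fin d → 𝔸) (hx : good x) :
    (cloc - (1 + t⁻¹) * ((1 : ℝ) ^ 2 * (Real.pi / (2 * L)) ^ 2 * (4 : ℕ) * (2 * (d - 1) : ℕ)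
        + (|Real.sqrt ((n : ℝ) ^ (d - 2)) * ((n : ℝ) ^ (d + 1))⁻¹| * n) ^ 2
            * (((d + 1) * (n - 1) : ℕ) * (Real.pi / (2 * L))) ^ 2 * (n ^ (d + 1) : ℕ) * (n : ℕ))) / (1 + t)
        * ∑ c, ‖x c‖ ^ 2
      ≤ ∑ P, X P (fun y μ => x (y, μ)) ^ 2
        + (n : ℝ) ^ (d - 2) * ∑ j : (Fin d → ZMod M) × Fin d, ‖Q0cov n V₀ (fun z ν => x (tcls (n * M) z, ν)) (qb j.1) j.2‖ ^ 2 := by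
  have hY : ∀ (j : (Fin d → ZMod M) × Fin d) (B : (Fin d → ZMod (n * M)) → Fin d → 𝔸),
      Real.sqrt ((n : ℝ) ^ (d - 2)) * ‖Q0cov n V₀ (fun z ν => B (tcls (n * M) z) ν) (qb j.1) j.2‖
        = ‖(Real.sqrt ((n : ℝ) ^ (d - 2)) * ((n : ℝ) ^ (d + 1))⁻¹) • ∑ rt : (Fin d → Fin n) × Fin n,
            conjR (hol V₀ (qb j.1) (treeWord (boxVec n rt.1) ++ seg j.2 ((rt.2 : ℕ) : ℤ))) (B (ιA j rt).1 (ιA j rt).2)‖ := by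
    rintro ⟨y, κ⟩ B
    rw [Q0cov_eq_weighted_sum, mul_smul, norm_smul (Real.sqrt _), Real.norm_eq_abs, abs_of_nonneg (Real.sqrt_nonneg _)]
    congr 3
    refine Finset.sum_congr rfl fun rt _ => ?_
    obtain ⟨r, s⟩ := rt
    rw [hιA, tcls_qb_add_boxVec_add n M qb hqb y κ r s]
  have key := ims_floor_full_form_sq n M L Mp hL hMp hN c₀ ι hι w hw R hR X hX ιA hιA
    (Real.sqrt ((n : ℝ) ^ (d - 2)) * ((n : ℝ) ^ (d + 1))⁻¹)
    (fun j rt => hol V₀ (qb j.1) (treeWord (boxVec n rt.1) ++ seg j.2 ((rt.2 : ℕ) : ℤ))) (fun j rt => hol_mem hV _ _) R' hR'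
    (fun j B => Real.sqrt ((n : ℝ) ^ (d - 2)) * ‖Q0cov n V₀ (fun z ν => B (tcls (n * M) z) ν) (qb j.1) j.2‖) hY good hloc ht x hx
  have hsq : ∀ j : (Fin d → ZMod M) × Fin d,
      (Real.sqrt ((n : ℝ) ^ (d - 2)) * ‖Q0cov n V₀ (fun z ν => x (tcls (n * M) z, ν)) (qb j.1) j.2‖) ^ 2
        = (n : ℝ) ^ (d - 2) * ‖Q0cov n V₀ (fun z ν => x (tcls (n * M) z, ν)) (qb j.1) j.2‖ ^ 2 := fun j => by
    rw [mul_pow, Real.sq_sqrt (by positivity)]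
  simp_rw [hsq, ← Finset.mul_sum] at key
  exact key

end Summit.QuantumFields.BalabanUV.T4Continuum.NE7b.FullFormSineFloorSq

end
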